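/-
Copyright: cell pub-balaban-gaps (YM BLITZ Y1, track G1), seat g1-p2 GEN 9 (unit `pub-balaban-gaps-g1-p2`).  Row (D4) NODE O,
JUNCTION J-3 (multi-level) — PRINT'S CLASS (3.37) LITERALLY AS A PRODUCT: *"We assume that they have the form U′U, where U has values in
G and U′ = e^{iηA′} … U satisfies the condition (3.35), and |A′| < α₁(Lʲη)^{−1}, |∇^η_U A′| < α₁(Lʲη)^{−2}"* ([B9] p. 396).  In the gauge `g`
of (3.35) for `U`: `g(U′U)g⁻(· + e_μ) = (gU′g⁻)(gUg⁻(· + e_μ)) = e^{X₁}e^{X₂}` with `X₂ = iηA` ((3.35)'s small field) and `X₁ = iη·Ad_g A′` (the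
perturbation read in that gauge) — so the hypothesis here is `g(y)U_μ(u;y)g⁻(y + e_μ) = e^{X₁,μ(u;y)}e^{X₂,μ(u;y)}` with BOTH exponents in the
(3.37) window, and the conclusion is Cor. 3.6 ∕ Thm 3.4's shape: the Green function of the covariant multi-level operator AT `U′U` ITSELF is
a block walk expansion (91b's transfer fed with the windows of a PRODUCT of two small exponentials).  HONEST FRAMING: `(g, X₁, X₂)` hypothesis
SHAPES; fundamental representation; unitary `g` costs 1 in operator norm, `r(g)r(g⁻)` here; flat operator = scalar model ⊗ 1; VALUE letters;
(D4) NOT discharged (instance 0∕1); NOT BetaPertH, NOT continuum, NOT Clay.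
-/
import Summits.QuantumFields.BalabanUV.Gaps.D4WalkBlockCovariantGaugeExpMultiLevel
import Summits.QuantumFields.BalabanUV.Gaps.D4WalkBlockAdjointWindow

/-!
# `Gaps.D4WalkBlockCovariantGaugeExp2MultiLevel` — the Green function at `U′U`: `U` gauge-equivalent to `e^{X₂}`, `U′ = e^{X₁}` in that
# gauge, both in the (3.37) window (cell pub-balaban-gaps, seat g1-p2 gen 9)

HONEST DEPENDENCY (cell pub-balaban, verbatim): continuum YM on T⁴ ⇐ BetaPertH ∧ nine spine estimates (0/9 proved);
BetaPertH ⇐ (D1) ∧ (D4) ∧ CAP+tail.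

* §1 windows of a product of two small exponentials: `rowSumNorm_exp_mul_exp_sub_one_le` (`Σ|(e^{X₁}e^{X₂} − 1)| ≤ α(2 + α)t` from
  `Σ|X_i| ≤ a₀t`, `α = a₀e^{a₀}`), `rowSumNorm_expProd_sub_expProd_le` (derivative window `2(1 + α)·a₁e^{La₀}·t²`).
* §2 **`blockWalkExpansion_covariantGreen_gaugeExp2_multiLevelTorus`**: 91b's gauge transfer with the gauge-transformed pair
  `(e^{X₁}e^{X₂}, e^{−X₂}e^{−X₁})`; `U`, `U⁻`, `UU⁻ = 1`, holomorphy DERIVED from the two gauge relations (86, `Matrix.exp_neg`).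
WHAT IT IS NOT.  (g, X₂) from small plaquettes ([5]∕[B10], row (D2)); the 𝔤-valuedness of `A, A′`; (D4) instance 0∕1; words UNCHANGED.

References: T. Bałaban, Comm. Math. Phys. **99** (1985) 389–434 [B9], (3.35)–(3.37) p. 396, p. 398, Thm 3.4 p. 399, Cor. 3.5 p. 407,
Cor. 3.6 p. 408; Comm. Math. Phys. **96** (1984) [4], (2.13)–(2.14) p. 225; Comm. Math. Phys. **116** (1988) [II], (1.11) p. 5, p. 15.
-/

noncomputable section

namespace Summit.QuantumFields.BalabanUV.Gaps.D4WalkBlockCovariantGaugeExp2MultiLevel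

open Metric NormedSpace
open scoped Matrix
open Literature.MathematicalPhysics.QuantumFieldTheory.Balaban1983to89
open Literature.MathematicalPhysics.QuantumFieldTheory.Balaban1983to89.B4Reflection242 (boxDom blk)
open Literature.MathematicalPhysics.QuantumFieldTheory.Balaban1983to89.B9SectDWalk (DomBy)
open Literature.MathematicalPhysics.QuantumFieldTheory.Balaban1983to89.B9Thm34Ext (toB6)
open Literature.MathematicalPhysics.QuantumFieldTheory.Balaban1983to89.B9Thm37GlueTorus (torusGeom tdist1)
open Literature.MathematicalPhysics.QuantumFieldTheory.Balaban1983to89.TreeLengthTorus (TPt)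
open Literature.MathematicalPhysics.QuantumFieldTheory.Balaban1983to89.B5TorusCover (UT)
open Literature.MathematicalPhysics.QuantumFieldTheory.Balaban1983to89.B11SectG (RowSum)
open Literature.MathematicalPhysics.QuantumFieldTheory.Balaban1983to89.B6MultiLevelBoxOperator (N0)
open Literature.MathematicalPhysics.QuantumFieldTheory.Balaban1983to89.B6MultiLevelTorusOperator (TDomains gmlT tshift unitVec)
open Literature.MathematicalPhysics.QuantumFieldTheory.Balaban1983to89.B6Ineq243TwoLevelBox (aNext)
open Summit.QuantumFields.BalabanUV.Gaps.D4WalkBlock (blockNorm BlockWalkExpansion)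
open Summit.QuantumFields.BalabanUV.Gaps.D4WalkBlockMultiLevelGeometry (cubeML)
open Summit.QuantumFields.BalabanUV.Gaps.D4WalkBlockTransportAlgebra (rowSumNorm)
open Summit.QuantumFields.BalabanUV.Gaps.D4WalkBlockShiftStep (covLap)
open Summit.QuantumFields.BalabanUV.Gaps.D4WalkBlockShiftWeighted (covDopW covBW covAlphaW)
open Summit.QuantumFields.BalabanUV.Gaps.D4WalkBlockWeightedLettersMultiLevel (levW)
open Summit.QuantumFields.BalabanUV.Gaps.D4WalkBlockCovariantAveragingMultiLevel (covAvgOp)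
open Summit.QuantumFields.BalabanUV.Gaps.D4WalkBlockCovariantContourMultiLevel (contourT contourTi)
open Summit.QuantumFields.BalabanUV.Gaps.D4WalkBlockCovariantBondFieldMultiLevel (inv_pow_lev_tshift_symm_le)
open Summit.QuantumFields.BalabanUV.Gaps.D4WalkBlockCovariantExpFieldMultiLevel (expWindow_bond expWindow_deriv)
open Summit.QuantumFields.BalabanUV.Gaps.D4WalkBlockExpHolo (differentiableOn_exp_entry_family differentiableOn_exp_neg_entry_family)
open Summit.QuantumFields.BalabanUV.Gaps.D4WalkBlockContourPath (IsPath)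
open Summit.QuantumFields.BalabanUV.Gaps.D4WalkBlockCovariantGaugeMultiLevel (blockWalkExpansion_covariantGreen_gauge_multiLevelTorus)
open Summit.QuantumFields.BalabanUV.Gaps.D4WalkBlockExpWindow (rowSumNorm_neg rowSumNorm_exp_sub_one_le rowSumNorm_exp_sub_exp_le exp_sub_one_le_eps)
open Summit.QuantumFields.BalabanUV.Gaps.D4WalkBlockTransportAlgebra (rowSumNorm_mul_le rowSumNorm_nonneg)
open Summit.QuantumFields.BalabanUV.Gaps.D4WalkBlockAdjointWindow (rowSumNorm_le_one_add)

variable {d : ℕ}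

/-! ## §1. Windows of a product of two small exponentials -/

section Windows

variable {N : ℕ}

/-- rows of `AB − 1 = (A − 1)B + (B − 1)`: `≤ s_A(1 + s) + s_B` (`s_B ≤ s`). -/
theorem rowSumNorm_mul_sub_one_le (A B : Matrix (Fin N) (Fin N) ℂ) {sA sB s : ℝ} (hA : ∀ a, rowSumNorm (A - 1) a ≤ sA)
    (hB : ∀ a, rowSumNorm (B - 1) a ≤ sB) (hBs : sB ≤ s) (a : Fin N) : rowSumNorm (A * B - 1) a ≤ sA * (1 + s) + sB := by
  have e : A * B - 1 = (A - 1) * B + (B - 1) := by rw [sub_mul, one_mul]; abel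
  rw [e]
  have h1 : rowSumNorm ((A - 1) * B + (B - 1)) a ≤ rowSumNorm ((A - 1) * B) a + rowSumNorm (B - 1) a := by
    unfold rowSumNorm; rw [← Finset.sum_add_distrib]
    exact Finset.sum_le_sum fun c _ => by rw [Matrix.add_apply]; exact norm_add_le _ _
  refine h1.trans (add_le_add ?_ (hB a))
  have hsB : 0 ≤ sB := (rowSumNorm_nonneg _ a).trans (hB a)
  exact (rowSumNorm_mul_le _ _ (rowSumNorm_le_one_add B (fun b => (hB b).trans hBs)) a).trans
    (mul_le_mul_of_nonneg_right (hA a) (by linarith))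

/-- rows of `AB − A′B′ = (A − A′)B + A′(B − B′)`: `≤ β_A(1 + s) + (1 + s)β_B`. -/
theorem rowSumNorm_mul_sub_mul_le (A A' B B' : Matrix (Fin N) (Fin N) ℂ) {s βA βB : ℝ} (hs : 0 ≤ s)
    (hA' : ∀ a, rowSumNorm (A' - 1) a ≤ s) (hB : ∀ a, rowSumNorm (B - 1) a ≤ s)
    (hdA : ∀ a, rowSumNorm (A - A') a ≤ βA) (hdB : ∀ a, rowSumNorm (B - B') a ≤ βB) (a : Fin N) :
    rowSumNorm (A * B - A' * B') a ≤ βA * (1 + s) + (1 + s) * βB := by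
  have e : A * B - A' * B' = (A - A') * B + A' * (B - B') := by rw [sub_mul, mul_sub]; abel
  rw [e]
  have h1 : rowSumNorm ((A - A') * B + A' * (B - B')) a ≤ rowSumNorm ((A - A') * B) a + rowSumNorm (A' * (B - B')) a := by
    unfold rowSumNorm; rw [← Finset.sum_add_distrib]
    exact Finset.sum_le_sum fun c _ => by rw [Matrix.add_apply]; exact norm_add_le _ _
  have hβB : 0 ≤ βB := (rowSumNorm_nonneg _ a).trans (hdB a)
  refine h1.trans (add_le_add ?_ ?_)
  · exact (rowSumNorm_mul_le _ _ (rowSumNorm_le_one_add B hB) a).trans (mul_le_mul_of_nonneg_right (hdA a) (by linarith))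
  · exact (rowSumNorm_mul_le _ _ hdB a).trans (mul_le_mul_of_nonneg_right (rowSumNorm_le_one_add A' hA' a) hβB)

end Windows

/-! ## §2. The Green function at `U′U` -/

section Green

variable {dd N' : ℕ} {E : Type*} [NormedAddCommGroup E] [NormedSpace ℂ E]

/-- **[B9] THM 3.4 ∕ COR. 3.6's SHAPE — THE GREEN FUNCTION AT `U′U`, `U` GAUGE-EQUIVALENT TO `e^{X₂}`, `U′ = e^{X₁}` IN THAT GAUGE, BOTH IN
THE (3.37) WINDOW.**  91b's transfer with the gauge-transformed pair `(e^{X₁}e^{X₂}, e^{−X₂}e^{−X₁})`: its windows from §1 with 85's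
`expWindow_bond` ∕ `expWindow_deriv` (`α₀ ↦ α(2 + α)`, `α = a₀e^{a₀}`; `α₁ ↦ 2(1 + α)a₁e^{La₀}`), holomorphy by 86, inverse by `Matrix.exp_neg`.
[cite: Balaban1985BackgroundPropagators, (3.35)–(3.37) p.396, Thm 3.4 p.399, Cor. 3.5 p.407, Cor. 3.6 p.408, p.398; Balaban1984PropagatorsII, (2.13)–(2.14) p.225; Balaban1988RG2Cluster, (1.11) p.5, p.15] -/
theorem blockWalkExpansion_covariantGreen_gaugeExp2_multiLevelTorus (d ℓ : ℕ) (hℓ : 1 ≤ ℓ) (aminus aplus a2minus a2plus : ℝ)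
    (ha : 0 < aminus) (ha2 : 0 < a2minus) :
    ∃ δ₁ C M₀ : ℝ, ∃ N₀ : ℕ, 0 < δ₁ ∧ 0 < C ∧ 0 < M₀ ∧ 0 < N₀ ∧
      ∀ (k Mh R : ℕ), 3 ≤ Mh → M₀ ≤ ((ℓ : ℝ) + 1) * Mh → 2 * (ℓ + 1) ≤ R → N₀ + 1 ≤ R * ((ℓ + 1) * Mh) →
      ∀ (P : Fin (d + 1) → ℕ) (hP : ∀ μ, 1 ≤ P μ) (hP4 : ∀ μ, 4 ≤ P μ) (D : TDomains d ℓ Mh k P R) (a c : ℕ → ℝ),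
        (∀ i, 1 ≤ i → aminus ≤ a i ∧ a i ≤ aplus) → (∀ i, 1 ≤ i → a2minus ≤ c i ∧ c i ≤ a2plus) →
        (∀ i, 1 ≤ i → a (i + 1) = aNext ℓ (a i) (c i)) →
      ∀ (Kc : Fin (d + 1) → ℕ) [∀ i, NeZero (Kc i)], (∀ i, N0 ℓ Mh k P i = (ℓ + 1) ^ k * Kc i) →
      ∀ (N : ℕ) (c₀ : B13.Consts) (Xs : Finset (UT Kc)) (Rb : ℝ)
        (U Ui X₁ X₂ : Fin (d + 1) → E → ↥(boxDom (N0 ℓ Mh k P)) → Matrix (Fin N) (Fin N) ℂ)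
        (Γ : ↥(boxDom (N0 ℓ Mh k P)) → List (↥(boxDom (N0 ℓ Mh k P)) × Fin (d + 1)))
        (β : ↥(boxDom (N0 ℓ Mh k P)) → ↥(boxDom (N0 ℓ Mh k P))) (g gi : ↥(boxDom (N0 ℓ Mh k P)) → Matrix (Fin N) (Fin N) ℂ)
        (r r' a₀ a₁ ε μ cμ : ℝ),
      (∀ x, g x * gi x = 1) → (∀ x, gi x * g x = 1) → 0 ≤ r → 0 ≤ r' → (∀ x a', ∑ b, ‖gi x a' b‖ ≤ r) →
      (∀ x a', ∑ b, ‖g x a' b‖ ≤ r') →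
      (∀ x, IsPath (fun ν => tshift (N0 ℓ Mh k P) (unitVec ν)) (Γ x) (β x) x) →
      (∀ x x' : ↥(boxDom (N0 ℓ Mh k P)), blk ((ℓ + 1) ^ D.lev x.1) x'.1 = blk ((ℓ + 1) ^ D.lev x.1) x.1 → β x' = β x) →
      (∀ ν u y, g y * U ν u y * gi ((tshift (N0 ℓ Mh k P) (unitVec ν)) y) = exp (X₁ ν u y) * exp (X₂ ν u y)) →
      (∀ ν u y, g ((tshift (N0 ℓ Mh k P) (unitVec ν)) y) * Ui ν u y * gi y = exp (-X₂ ν u y) * exp (-X₁ ν u y)) →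
      (∀ ν y a' b, DifferentiableOn ℂ (fun u => X₁ ν u y a' b) (ball (0 : E) Rb)) →
      (∀ ν y a' b, DifferentiableOn ℂ (fun u => X₂ ν u y a' b) (ball (0 : E) Rb)) → 0 ≤ a₀ → 0 ≤ a₁ →
      (∀ ν, ∀ u ∈ ball (0 : E) Rb, ∀ y a', rowSumNorm (X₁ ν u y) a' ≤ a₀ * ((((ℓ : ℝ) + 1) ^ D.lev y.1))⁻¹) →
      (∀ ν, ∀ u ∈ ball (0 : E) Rb, ∀ y a', rowSumNorm (X₂ ν u y) a' ≤ a₀ * ((((ℓ : ℝ) + 1) ^ D.lev y.1))⁻¹) →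
      (∀ ν, ∀ u ∈ ball (0 : E) Rb, ∀ x a', rowSumNorm (X₁ ν u x - X₁ ν u ((tshift (N0 ℓ Mh k P) (unitVec ν)).symm x)) a' ≤
        a₁ * ((((ℓ : ℝ) + 1) ^ D.lev x.1))⁻¹ ^ 2) →
      (∀ ν, ∀ u ∈ ball (0 : E) Rb, ∀ x a', rowSumNorm (X₂ ν u x - X₂ ν u ((tshift (N0 ℓ Mh k P) (unitVec ν)).symm x)) a' ≤
        a₁ * ((((ℓ : ℝ) + 1) ^ D.lev x.1))⁻¹ ^ 2) →
      (∀ x, (Γ x).length ≤ (d + 1) * (ℓ + 1) ^ D.lev x.1) →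
      (∀ x, ∀ b ∈ Γ x, blk ((ℓ + 1) ^ D.lev x.1) b.1.1 = blk ((ℓ + 1) ^ D.lev x.1) x.1) →
      0 ≤ μ → 2 * μ ≤ ε → 2 * μ ≤ δ₁ - ε - μ → 0 ≤ cμ →
      RowSum (toB6 (torusGeom Kc 0 0 0) 0 True) μ cμ →
      cμ * (cμ * 1 * (1 * ((0 + ∑ j : Unit ⊕ (Fin (d + 1) ⊕ Fin (d + 1)),
        covAlphaW (((ℓ : ℝ) + 1) * ((a₀ * Real.exp a₀) * (2 + (a₀ * Real.exp a₀)))) (((d : ℝ) + 1) * ((2 * (1 + (a₀ * Real.exp a₀)) * (a₁ * Real.exp (((ℓ : ℝ) + 1) * a₀))) + (((ℓ : ℝ) + 1) * ((a₀ * Real.exp a₀) * (2 + (a₀ * Real.exp a₀)))) ^ 2) +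
          aplus * (Real.exp (2 * ((d : ℝ) + 1) * ((a₀ * Real.exp a₀) * (2 + (a₀ * Real.exp a₀)))) - 1)) j * covBW δ₁ ((ℓ : ℝ) + 1) j) * C)) * cμ) * cμ < 1 →
      ∃ (W : Type) (T : W → (TPt dd N' → ℂ) → E → Matrix (↥(boxDom (N0 ℓ Mh k P)) × Fin N) (↥(boxDom (N0 ℓ Mh k P)) × Fin N) ℂ)
        (SX' : Set W) (A' : W → ℝ) (D' : W → UT Kc → UT Kc → ℝ),
        BlockWalkExpansion c₀ (fun q : ↥(boxDom (N0 ℓ Mh k P)) × Fin N => cubeML ℓ k Kc q.1.1)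
          (fun q : ↥(boxDom (N0 ℓ Mh k P)) × Fin N => cubeML ℓ k Kc q.1.1)
          (fun (_ : TPt dd N' → ℂ) u =>
            (covLap ↥(boxDom (N0 ℓ Mh k P)) (Fin N) (fun ν => tshift (N0 ℓ Mh k P) (unitVec ν)) ((((ℓ : ℝ) + 1) ^ k)⁻¹)
                (fun ν u x => U ν u x - 1) (fun ν u x => Ui ν u ((tshift (N0 ℓ Mh k P) (unitVec ν)).symm x) - 1) u +
              (((ℓ : ℂ) + 1) ^ (2 * k) : ℂ) • covAvgOp D a (contourT Γ fun u b => U b.2 u b.1) (contourTi Γ fun u b => Ui b.2 u b.1) u)⁻¹)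
          Xs Rb (ε - 2 * μ) (δ₁ - ε - μ - 2 * μ)
          (r * r' * (cμ * C * (1 * (1 - cμ * (cμ * 1 * (1 * ((0 + ∑ j : Unit ⊕ (Fin (d + 1) ⊕ Fin (d + 1)),
            covAlphaW (((ℓ : ℝ) + 1) * ((a₀ * Real.exp a₀) * (2 + (a₀ * Real.exp a₀)))) (((d : ℝ) + 1) * ((2 * (1 + (a₀ * Real.exp a₀)) * (a₁ * Real.exp (((ℓ : ℝ) + 1) * a₀))) + (((ℓ : ℝ) + 1) * ((a₀ * Real.exp a₀) * (2 + (a₀ * Real.exp a₀)))) ^ 2) +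
              aplus * (Real.exp (2 * ((d : ℝ) + 1) * ((a₀ * Real.exp a₀) * (2 + (a₀ * Real.exp a₀)))) - 1)) j * covBW δ₁ ((ℓ : ℝ) + 1) j) * C)) * cμ) * cμ)⁻¹) * cμ))
          T SX' A' D' (δ₁ - 2 * μ) ∧
        ∀ ω, DomBy (toB6 (torusGeom Kc 0 0 0) 0 True) (D' ω) := by
  obtain ⟨δ₁, C, M₀, N₀, hδ₁, hC, hM₀, hN₀, hmain⟩ :=
    blockWalkExpansion_covariantGreen_gauge_multiLevelTorus (dd := dd) (N' := N') (E := E) d ℓ hℓ aminus aplus a2minus a2plus ha ha2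
  refine ⟨δ₁, C, M₀, N₀, hδ₁, hC, hM₀, hN₀, ?_⟩
  intro k Mh R hMh hM hR hRM P hP hP4 D a c haw hcw hac Kc _ hKc N c₀ Xs Rb U Ui X₁ X₂ Γ β g gi r r' a₀ a₁ ε μ cμ hg hgi hr0 hr0' hr
    hr' hpath hβ hgauge hgaugei hX₁h hX₂h ha₀ ha₁ hX₁0 hX₂0 hX₁1 hX₂1 hlen hblkΓ hμ hμε hμκ hcμ hrow hq
  have hMh1 : 1 ≤ Mh := le_trans (by norm_num) hMh
  have hR1 : 1 ≤ R := le_trans (by omega) hR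
  set SH := fun ν => tshift (N0 ℓ Mh k P) (unitVec ν) with hSH
  -- U and U⁻ from the gauge relations
  have hU : ∀ ν u y, U ν u y = gi y * (exp (X₁ ν u y) * exp (X₂ ν u y)) * g ((tshift (N0 ℓ Mh k P) (unitVec ν)) y) := by
    intro ν u y
    rw [← hgauge ν u y]
    simp only [← Matrix.mul_assoc]
    rw [hgi, Matrix.one_mul, Matrix.mul_assoc, hgi, Matrix.mul_one]
  have hUi : ∀ ν u y, Ui ν u y = gi ((tshift (N0 ℓ Mh k P) (unitVec ν)) y) * (exp (-X₂ ν u y) * exp (-X₁ ν u y)) * g y := by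
    intro ν u y
    rw [← hgaugei ν u y]
    simp only [← Matrix.mul_assoc]
    rw [hgi, Matrix.one_mul, Matrix.mul_assoc, hgi, Matrix.mul_one]
  have hc : ∀ (M : Matrix (Fin N) (Fin N) ℂ) a' b, DifferentiableOn ℂ (fun _ : E => M a' b) (ball (0 : E) Rb) := fun M a' b =>
    differentiableOn_const _
  have hE₁ := differentiableOn_exp_entry_family hX₁h
  have hE₂ := differentiableOn_exp_entry_family hX₂h
  have hEi₁ := differentiableOn_exp_neg_entry_family hX₁h
  have hEi₂ := differentiableOn_exp_neg_entry_family hX₂h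
  have hUh : ∀ ν y a' b, DifferentiableOn ℂ (fun u => U ν u y a' b) (ball (0 : E) Rb) := by
    intro ν y a' b
    simp only [hU]
    exact D4WalkProduct.differentiableOn_mul_entry (M₁ := fun u => gi y * (exp (X₁ ν u y) * exp (X₂ ν u y)))
      (D4WalkProduct.differentiableOn_mul_entry (hc (gi y)) (D4WalkProduct.differentiableOn_mul_entry (hE₁ ν y) (hE₂ ν y))) (hc _) a' b
  have hUih : ∀ ν y a' b, DifferentiableOn ℂ (fun u => Ui ν u y a' b) (ball (0 : E) Rb) := by
    intro ν y a' b
    simp only [hUi]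
    exact D4WalkProduct.differentiableOn_mul_entry (M₁ := fun u => gi _ * (exp (-X₂ ν u y) * exp (-X₁ ν u y)))
      (D4WalkProduct.differentiableOn_mul_entry (hc (gi _)) (D4WalkProduct.differentiableOn_mul_entry (hEi₂ ν y) (hEi₁ ν y))) (hc _) a' b
  have hexp : ∀ (Y : Matrix (Fin N) (Fin N) ℂ), exp Y * exp (-Y) = 1 := fun Y => by
    rw [Matrix.exp_neg]; exact Matrix.mul_nonsing_inv _ ((Matrix.isUnit_iff_isUnit_det _).1 (Matrix.isUnit_exp _))
  have hprod : ∀ ν u y, exp (X₁ ν u y) * exp (X₂ ν u y) * (exp (-X₂ ν u y) * exp (-X₁ ν u y)) = 1 := by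
    intro ν u y
    calc exp (X₁ ν u y) * exp (X₂ ν u y) * (exp (-X₂ ν u y) * exp (-X₁ ν u y))
        = exp (X₁ ν u y) * (exp (X₂ ν u y) * exp (-X₂ ν u y)) * exp (-X₁ ν u y) := by simp only [Matrix.mul_assoc]
      _ = 1 := by rw [hexp, Matrix.mul_one, hexp]
  have hinv : ∀ ν u y, U ν u y * Ui ν u y = 1 := by
    intro ν u y
    rw [hU, hUi]
    calc gi y * (exp (X₁ ν u y) * exp (X₂ ν u y)) * g ((tshift (N0 ℓ Mh k P) (unitVec ν)) y) *
          (gi ((tshift (N0 ℓ Mh k P) (unitVec ν)) y) * (exp (-X₂ ν u y) * exp (-X₁ ν u y)) * g y)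
        = gi y * (exp (X₁ ν u y) * exp (X₂ ν u y)) * (g ((tshift (N0 ℓ Mh k P) (unitVec ν)) y) *
            gi ((tshift (N0 ℓ Mh k P) (unitVec ν)) y)) * (exp (-X₂ ν u y) * exp (-X₁ ν u y)) * g y := by
          simp only [Matrix.mul_assoc]
      _ = 1 := by rw [hg, Matrix.mul_one, Matrix.mul_assoc (gi y), hprod, Matrix.mul_one, hgi]
  -- windows of the single exponentials (85 §1)
  obtain ⟨hE₁0, hEi₁0⟩ := expWindow_bond (D := D) (X := X₁) ha₀ hX₁0
  obtain ⟨hE₂0, hEi₂0⟩ := expWindow_bond (D := D) (X := X₂) ha₀ hX₂0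
  have hE₁1 := expWindow_deriv (D := D) (X := X₁) hR1 hMh1 hP ha₀ ha₁ hX₁0 hX₁1
  have hE₂1 := expWindow_deriv (D := D) (X := X₂) hR1 hMh1 hP ha₀ ha₁ hX₂0 hX₂1
  have ht1 : ∀ y : ↥(boxDom (N0 ℓ Mh k P)), ((((ℓ : ℝ) + 1) ^ D.lev y.1))⁻¹ ≤ 1 := fun y =>
    D4WalkBlockCovariantExpFieldMultiLevel.inv_pow_lev_le_one (D := D) y
  have hαle : ∀ y : ↥(boxDom (N0 ℓ Mh k P)), (a₀ * Real.exp a₀) * ((((ℓ : ℝ) + 1) ^ D.lev y.1))⁻¹ ≤ a₀ * Real.exp a₀ := fun y =>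
    mul_le_of_le_one_right (by positivity) (ht1 y)
  refine hmain k Mh R hMh hM hR hRM P hP hP4 D a c haw hcw hac Kc hKc (Fin N) c₀ Xs Rb U Ui Γ β g gi r r'
    ((a₀ * Real.exp a₀) * (2 + (a₀ * Real.exp a₀))) (2 * (1 + (a₀ * Real.exp a₀)) * (a₁ * Real.exp (((ℓ : ℝ) + 1) * a₀))) ε μ cμ
    hg hgi hr0 hr0' hr hr' hpath hβ hUh hUih hinv (by positivity) (by positivity)
    (fun ν u hu y a' => ?_) (fun ν u hu y a' => ?_) (fun ν u hu x a' => ?_) hlen hblkΓ hμ hμε hμκ hcμ hrow hq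
  · -- bond window of e^{X₁}e^{X₂} − 1
    rw [hgauge]
    have h := rowSumNorm_mul_sub_one_le (exp (X₁ ν u y)) (exp (X₂ ν u y)) (hE₁0 ν u hu y) (hE₂0 ν u hu y) (hαle y) a'
    refine h.trans (le_of_eq ?_); ring
  · -- bond window of e^{−X₂}e^{−X₁} − 1
    rw [hgaugei]
    have h := rowSumNorm_mul_sub_one_le (exp (-X₂ ν u y)) (exp (-X₁ ν u y)) (hEi₂0 ν u hu y) (hEi₁0 ν u hu y) (hαle y) a'
    refine h.trans (le_of_eq ?_); ring
  · -- derivative window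
    rw [hgauge, hgauge]
    have h := rowSumNorm_mul_sub_mul_le (exp (X₁ ν u x)) (exp (X₁ ν u ((tshift (N0 ℓ Mh k P) (unitVec ν)).symm x)))
      (exp (X₂ ν u x)) (exp (X₂ ν u ((tshift (N0 ℓ Mh k P) (unitVec ν)).symm x))) (by positivity : (0 : ℝ) ≤ a₀ * Real.exp a₀)
      (fun b => (hE₁0 ν u hu _ b).trans (hαle _)) (fun b => (hE₂0 ν u hu _ b).trans (hαle _)) (hE₁1 ν u hu x) (hE₂1 ν u hu x) a'
    refine h.trans (le_of_eq ?_); ring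

end Green

end Summit.QuantumFields.BalabanUV.Gaps.D4WalkBlockCovariantGaugeExp2MultiLevel

end
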